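import Summits.BirchSwinnertonDyer.Rank1Residual.Additive.LocIrrOfSubGss
import Summits.BirchSwinnertonDyer.Rank1Residual.O5.GssTwistDictionary
import Literature.NumberTheory.EllipticCurves.BSDSelmerCMPConverseRankOneProofs
import HarnessLib

/-!
# `LocIrr` descends to global irreducibility, and `(G) ∧ ss ⇒ LocIrr` at EVERY odd prime
# (cell `b2b-bsdres`, lane CLASS-CLOSURE, class O5; harvest seat 2, GEN 48, E102, part 1/2)

HONEST FRAMING (cell `b2b-bsdres`, run/shared/lean/b2b/bsd-rank1-residual/, verbatim in every
file): the goal of the cell is to DELETE the COMBINATION-SHAPED residual classes of the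
Birch–Swinnerton-Dyer formula for ALL analytic-rank `≤ 1` elliptic curves over `ℚ` — "full BSD
formula for every rank `≤ 1` curve in class `C`" assembled STRICTLY from published theorems — so
that the rank-`≤ 1` remainder becomes exactly the CONSTRUCTION-SHAPED classes, which are TYPED
(missing-input `Prop`s), NOT attempted. This is not "finishing BSD". Lane CLASS-CLOSURE: research
routes; no claim beyond the stated classes; nothing is booked here; no mark of `RESIDUAL-MAP.md`
moves. THEOREMS ONLY (no definition, no named fact, no conjecture node; net named-fact debt `0`).

## What this file does

GEN 47 (E101) proved Serre 1972 §1.11 Prop. 12 in local form (`locIrr_of_dvd_frobeniusTrace`: at an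
odd prime of good supersingular reduction `E[p]|G_{ℚ_p}` is irreducible) and, on the O5 census cell
`(G) ∧ ss`, `locIrr_of_subGss : 5 ≤ p → Addv W p → SubGss W p → LocIrr W p` through the `p ≥ 5`
twist lemmas of `Additive/GordTwistOrdinary.lean`. Two things were left implicit and are made
kernel theorems here:

* §1 **`hasIrreducibleModPGaloisRep_of_baseChange`** — irreducibility of `E[p]` DESCENDS along any
  extension of the ground field: for `V/K` (characteristic `0`) and a `K`-field `E`, if
  `(V ⊗_K E)[p]` is an irreducible `Γ_E`-module then `V[p]` is an irreducible `Γ_K`-module (a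
  `Γ_K`-stable subgroup of `E[p](K̄)` is carried by the `Γ_E`-equivariant torsion transfer
  `E[p](K̄) ≃+ (V⁄E)[p](Ē)` of `Literature/…/LocalKummerIsotropyTransport.lean` to a
  `Γ_E`-stable subgroup). For `W/ℚ` and `E = ℚ_p`: **`irr_of_locIrr : LocIrr W p → Irr W p`** —
  the cell's (Lgl) bit implies GLOBAL irreducibility; hence `natCard_torsionBy_eq_one_of_locIrr`
  (`#E(ℚ)[p] = 1`, Mazur's "a rational point of order `p` spans a stable line", tree theorem
  `natCard_torsionBy_eq_one_of_hasIrreducibleModPGaloisRep`), `classX4_of_addv_of_locIrr` /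
  `not_classX3_of_locIrr` (a `LocIrr` row of the odd additive locus is an X4 row, never X3), and
  `not_locIrr_of_red`. Consequence for the O5 node files (`O5/O5GlobalLine.lean`,
  `O5/O5KummerLine.lean`, `O5/O5UncleanParity.lean`, `O5/O5KummerLineLocalSign.lean`), which carry
  BOTH `LocIrr W 3` and `W.HasIrreducibleModPGaloisRep 3` as hypotheses: the second follows from the
  first (`irr_three_of_locIrr_three`); nothing in those files is touched (typer's pen).
* §2 **`locIrr_of_subGss_of_ne_two : p ≠ 2 → Addv W p → SubGss W p → LocIrr W p`** — E101's
  `locIrr_of_subGss` at EVERY odd prime, `p = 3` included: the tree's SUPPLY theorem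
  `O5.exists_goodSS_twist_pStar_of_subGss` (`O5/GssTwistDictionary.lean`, cc-typer-5; at `p = 3` it
  rests on `subGss_three_iff_subGord_and_goodSS_twist`, `O5/GssSplitThree.lean`) produces a globally
  minimal model `Wd = C • E^{(p*)}`, `p* = (−1)^{⌊p/2⌋} p`, with GOOD SUPERSINGULAR reduction at `p`;
  `LocIrr Wd p` by Serre's Prop. 12 (`locIrr_of_dvd_frobeniusTrace`, `p ≠ 2`), and `LocIrr W p` by
  model and twist invariance (`locIrr_smul_iff`, `locIrr_quadraticTwist_iff`, E101 §2). Corollaries: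
  `locIrr_of_classO5_of_subGss` (the class's own `p ≠ 2 ∧ Addv`), the `p = 3` instance
  `locIrr_three_of_classO5_of_subGss` in the exact shape of the binder `hgss` of
  `O5.rootNumberTwisted_of_jump` (`O5/O5GlobalLine.lean` §3; discharged in part 2/2,
  `O5/RootNumberTwistedOfJumpParity.lean`), `irr_of_subGss_of_ne_two` and
  `classX4_of_subGss_of_ne_two` (the cell `(G) ∧ ss` lies in X4 at every odd `p` — the tree had
  "EMPTY on X3", `not_subGss_of_classX3`, by the (G)-ordinary route).

Census reading (EVIDENCE, rmap-2 S-b / census-lead; no label is moved here): `(G) ∧ ss` carries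
`770` X4 pairs at `p ≥ 5` (E101) and `9 744` X4 pairs at `p = 3` (this file): on all of them the
Fouquet–Wan (Lgl) bit `LocIrr` is now a THEOREM of the tree. O5 stays OPEN (this is a hypothesis bit
of an announced result, FW 2021 = PRE; nothing is booked).

References: J.-P. Serre, *Propriétés galoisiennes des points d'ordre fini des courbes elliptiques*,
Invent. Math. 15 (1972) 259–331, §1.11 Prop. 12 [Serre1972]; B. Mazur, *Modular curves and the
Eisenstein ideal*, Publ. Math. IHÉS 47 (1977), Ch. III §5 p. 157 [Mazur1977]; J. H. Silverman, *AEC*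
(2009), X.5 Cor. 5.4, VIII.8.3 [SilvermanAEC2009]; D. Delbourgo, Compositio Math. 113 (1998) §1.5 (G)
[Delbourgo1998]; cell: HOME/b2b-bsdres-harvest-2/gen47/E101, gen48/E102.
-/

set_option autoImplicit false

noncomputable section

open scoped Classical

open WeierstrassCurve Literature.NumberTheory.EllipticCurves
  Literature.NumberTheory.EllipticCurves.Rank1Residual
  Literature.NumberTheory.GaloisRepresentations Field
  Summit.BirchSwinnertonDyer.Rank1Residual.O5

namespace Summit.BirchSwinnertonDyer.Rank1Residual.Additive

/-! ## §1 Irreducibility of `E[p]` descends along a field extension; `LocIrr ⇒ Irr` -/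

section Descent

universe u

variable {K : Type u} [Field K] [CharZero K] (V : WeierstrassCurve K) [V.IsElliptic]
  (E : Type u) [Field E] [Algebra K E]

/-- **Irreducibility of `E[p]` descends from an extension of the ground field.** For `V/K`
(`char K = 0`), a `K`-field `E` and `p ≠ 0`: if `(V ⊗_K E)[p](Ē)` is an irreducible `Γ_E`-module,
then `V[p](K̄)` is an irreducible `Γ_K`-module. A `Γ_K`-stable subgroup `H ≤ V[p](K̄)` is carried by
the torsion transfer `t : V[p](K̄) ≃+ (V⁄E)[p](Ē)` (`torsionTransferEquiv`, equivariant along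
`res : Γ_E → Γ_K`, `torsionTransferEquiv_symm_smul`) to the subgroup `t(H) = {Q | t⁻¹ Q ∈ H}`, which
is `Γ_E`-stable (`σ • Q = t (res σ • t⁻¹ Q)`); so `t(H) = ⊥` or `⊤`, i.e. `H = ⊥` or `⊤`. [folklore] -/
theorem hasIrreducibleModPGaloisRep_of_baseChange {p : ℕ} (hp : p ≠ 0)
    (h : (V.baseChange E).HasIrreducibleModPGaloisRep p) : V.HasIrreducibleModPGaloisRep p := by
  intro H hH
  have hp0 : (p : ℤ) ≠ 0 := by exact_mod_cast hp
  let t := V.torsionTransferEquiv (E := E) hp0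
  let H' : AddSubgroup (geomTorsion (V.baseChange E) (p : ℤ)) := H.comap t.symm.toAddMonoidHom
  have hmem : ∀ Q, Q ∈ H' ↔ t.symm Q ∈ H := fun Q ↦ Iff.rfl
  have hH' : ∀ σ : absoluteGaloisGroup E, ∀ Q ∈ H', σ • Q ∈ H' := by
    intro σ Q hQ
    rw [hmem] at hQ ⊢
    rw [V.torsionTransferEquiv_symm_smul (E := E) hp0 σ Q]
    exact hH _ _ hQ
  rcases h H' hH' with hbot | htop
  · left
    rw [eq_bot_iff]
    intro P hP
    have htP : t P ∈ H' := by rw [hmem, t.symm_apply_apply]; exact hP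
    rw [hbot, AddSubgroup.mem_bot] at htP
    rw [AddSubgroup.mem_bot, ← t.map_eq_zero_iff]
    exact htP
  · right
    rw [eq_top_iff]
    intro P _
    have htP : t P ∈ H' := by rw [htop]; exact AddSubgroup.mem_top _
    rw [hmem, t.symm_apply_apply] at htP
    exact htP

end Descent

section LocIrrGlobal

variable (W : WeierstrassCurve ℚ) [W.IsElliptic] (p : ℕ) [hp : Fact p.Prime]

/-- **`LocIrr ⇒ Irr`: if `E[p]` is an irreducible `Gal(ℚ̄_p/ℚ_p)`-module it is an irreducible
`Gal(ℚ̄/ℚ)`-module** (`LocIrr W p := (W ⊗ ℚ_p).HasIrreducibleModPGaloisRep p`, file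
`Additive/FouquetWanLocus.lean`; descent §1 with `E = ℚ_p`). [folklore] -/
theorem irr_of_locIrr (hL : LocIrr W p) : W.HasIrreducibleModPGaloisRep p :=
  hasIrreducibleModPGaloisRep_of_baseChange W ℚ_[p] hp.out.ne_zero hL

/-- The `p = 3` instance, in the vocabulary of the O5 node files (which list `LocIrr W 3` and
`W.HasIrreducibleModPGaloisRep 3` as two hypotheses — the second is implied by the first). [folklore] -/
theorem irr_three_of_locIrr_three (W : WeierstrassCurve ℚ) [W.IsElliptic] (hL : LocIrr W 3) :
    W.HasIrreducibleModPGaloisRep 3 :=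
  irr_of_locIrr W 3 hL

/-- Contrapositive in census vocabulary: a `Red` pair (rational `p`-isogeny) is never `LocIrr`.
[folklore] -/
theorem not_locIrr_of_red (hred : Red W p) : ¬ LocIrr W p := fun hL ↦ hred (irr_of_locIrr W p hL)

/-- **No rational `p`-torsion on a `LocIrr` curve**: `#E(ℚ)[p] = 1` (Mazur: a rational point of
order `p` spans a `Γ_ℚ`-stable line; tree theorem
`natCard_torsionBy_eq_one_of_hasIrreducibleModPGaloisRep`). [cite: Mazur1977, Ch. III §5, p. 157] -/
theorem natCard_torsionBy_eq_one_of_locIrr (hL : LocIrr W p) :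
    Nat.card (AddSubgroup.torsionBy W.toAffine.Point (p : ℤ)) = 1 :=
  natCard_torsionBy_eq_one_of_hasIrreducibleModPGaloisRep W p (irr_of_locIrr W p hL)

/-- Class bookkeeping: an odd additive `LocIrr` pair is an X4 pair (`ClassX4 = p ≠ 2 ∧ Addv ∧ Irr`).
[folklore] -/
theorem classX4_of_addv_of_locIrr (hp2 : p ≠ 2) (hadd : Addv W p) (hL : LocIrr W p) :
    ClassX4 W p :=
  ⟨hp2, hadd, irr_of_locIrr W p hL⟩

/-- Class bookkeeping: a `LocIrr` pair is never an X3 pair (`ClassX3 = Red ∧ Addv`). [folklore] -/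
theorem not_classX3_of_locIrr (hL : LocIrr W p) : ¬ ClassX3 W p := fun h ↦
  h.1 (irr_of_locIrr W p hL)

end LocIrrGlobal

/-! ## §2 The O5 cell `(G) ∧ ss` at every odd prime: `LocIrr` -/

section SubGssOdd

variable (W : WeierstrassCurve ℚ) [W.IsElliptic] [W.IsGloballyMinimal] (p : ℕ) [hp : Fact p.Prime]

/-- **On `(G) ∧ ss` at ANY odd prime, `E[p]|G_{ℚ_p}` is irreducible**: `p ≠ 2 → Addv W p →
SubGss W p → LocIrr W p`. The supply theorem `exists_goodSS_twist_pStar_of_subGss` gives a globally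
minimal `Wd = C • E^{(p*)}` with good SUPERSINGULAR reduction at `p` (`GoodSS Wd p`); Serre's
Prop. 12 in local form (`locIrr_of_dvd_frobeniusTrace`) gives `LocIrr Wd p`; model and twist
invariance (`locIrr_smul_iff`, `locIrr_quadraticTwist_iff`) carry it back to `W`. At `p ≥ 5` this
is E101's `locIrr_of_subGss`; the point is `p = 3` (`p* = −3`, `a₃(Wd) ∈ {0, ±3}`).
[cite: Serre1972, §1.11 Prop. 12] [cite: SilvermanAEC2009, X.5 Cor. 5.4] [cite: Delbourgo1998, §1.5 (G)] -/
theorem locIrr_of_subGss_of_ne_two (hp2 : p ≠ 2) (hadd : Addv W p) (hG : SubGss W p) : LocIrr W p := by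
  obtain ⟨Wd, hE, hM, C, hC, hss⟩ := exists_goodSS_twist_pStar_of_subGss W p hp2 hadd hG
  haveI := hE
  haveI := hM
  have hV : LocIrr Wd p := locIrr_of_dvd_frobeniusTrace Wd p hp2 hss.1 hss.2
  rw [← hC, locIrr_smul_iff, locIrr_quadraticTwist_iff W p (pStar_ne_zero p)] at hV
  exact hV

/-- On the `(G) ∧ ss` half of class O5 (the class supplies `p ≠ 2 ∧ Addv W p`): `LocIrr W p`.
[cite: Serre1972, §1.11 Prop. 12] -/
theorem locIrr_of_classO5_of_subGss (hO : ClassO5 W p) (hG : SubGss W p) : LocIrr W p :=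
  locIrr_of_subGss_of_ne_two W p hO.1 hO.2.1 hG

/-- **The `p = 3` instance** — the binder `hgss` of `O5.rootNumberTwisted_of_jump`
(`O5/O5GlobalLine.lean` §3: "an I₀*-supersingular curve is locally irreducible at `3`: twist of a
good supersingular curve, GEN 6 Thm 2 with `m = 2`") word for word. [cite: Serre1972, §1.11 Prop. 12] -/
theorem locIrr_three_of_classO5_of_subGss (E : WeierstrassCurve ℚ) [E.IsElliptic]
    [E.IsGloballyMinimal] (hO : ClassO5 E 3) (hG : SubGss E 3) : LocIrr E 3 :=
  locIrr_of_classO5_of_subGss E 3 hO hG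

/-- `(G) ∧ ss` at an odd prime is GLOBALLY irreducible (`Irr W p`). [cite: Serre1972, §1.11 Prop. 12] -/
theorem irr_of_subGss_of_ne_two (hp2 : p ≠ 2) (hadd : Addv W p) (hG : SubGss W p) : Irr W p :=
  irr_of_locIrr W p (locIrr_of_subGss_of_ne_two W p hp2 hadd hG)

/-- Class bookkeeping: the census cell `(G) ∧ ss` at an odd prime lies in X4 (the tree's
`not_subGss_of_classX3` said "EMPTY on X3" through the (G)-ordinary dictionary; this is the positive
form). [folklore] -/
theorem classX4_of_subGss_of_ne_two (hp2 : p ≠ 2) (hadd : Addv W p) (hG : SubGss W p) : ClassX4 W p :=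
  ⟨hp2, hadd, irr_of_subGss_of_ne_two W p hp2 hadd hG⟩

/-- No rational `p`-torsion on `(G) ∧ ss` at an odd prime: `#E(ℚ)[p] = 1`.
[cite: Mazur1977, Ch. III §5, p. 157] -/
theorem natCard_torsionBy_eq_one_of_subGss_of_ne_two (hp2 : p ≠ 2) (hadd : Addv W p)
    (hG : SubGss W p) : Nat.card (AddSubgroup.torsionBy W.toAffine.Point (p : ℤ)) = 1 :=
  natCard_torsionBy_eq_one_of_locIrr W p (locIrr_of_subGss_of_ne_two W p hp2 hadd hG)

/-- **The `(G) ∧ ss` row of T-O5-CS at every odd prime**: `LocIrr W p`, and for `p ≥ 5` the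
canonical-subgroup criterion fails (E100/E101; at `p = 3` the criterion is not the cell's test —
`LocIrrThreeIffCriterion`, E89, is). [cite: Serre1972, §1.11 Prop. 12]
[cite: Kraus1997Dissertationes, Lemme 2 (p. 10), case v(Δ) = 6] -/
theorem locIrr_and_not_canonicalSubgroupCriterion_of_subGss' (hp2 : p ≠ 2) (hadd : Addv W p)
    (hG : SubGss W p) : LocIrr W p ∧ (5 ≤ p → ¬ CanonicalSubgroupCriterion p W) :=
  ⟨locIrr_of_subGss_of_ne_two W p hp2 hadd hG,
    fun hp5 ↦ not_canonicalSubgroupCriterion_of_subGss W p hp5 hadd hG⟩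

end SubGssOdd

end Summit.BirchSwinnertonDyer.Rank1Residual.Additive

end
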